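import Summits.NavierStokesRegularity.NavierStokesRegularity.Theorems.ExtremiserTransienceRegularisedNearPlateauStabilitySparseBangBangRadialPotential
import Summits.NavierStokesRegularity.NavierStokesRegularity.Theorems.ExtremiserTransienceRegularisedNearPlateauStabilitySparseBangBangClusters
import Mathlib.Analysis.Calculus.BumpFunction.InnerProduct
import Mathlib.Analysis.Normed.Module.Ball.Pointwise
import HarnessLib

/-!
# Route `ExtremiserTransience`, crux `RegularisedNearPlateauStability` (stmt-NavierStokesRegularity-28317),
# LINE g8-α «sparse bang-bang»: THE PATCHED RADIAL POTENTIAL `ψ̂` OVER THE CLUSTER COVER OF THE HALF-TOP SET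

`--supports stmt-NavierStokesRegularity-28317` (helper). Author: prover seat `ns-net-p2` (g2).

The potential half of step P4 (`TopTestField`) of `Cruxes/NearExtremalTransiencePerFlow/Lines/sparse_bangbang.lean`.
Given a smooth divergence-free field with the uniform derivative budget `‖Dⁱv‖ ≤ S·M·Lⁱ` (`i ≤ 3`, `λL = 1`) whose
half-top set `T = {‖v‖ ≥ M/2}` has at most `m₀` points in any `λ`-separated subset (the Sobolev count of the sparse
class, `…SparseBangBangCount`), `exists_patchedPotential` produces a GLOBAL smooth field `ψ̂` and a compact set `K ⊇ T`
of volume `≤ m₀·ρ₀³·|B₁|·λ³` (`ρ₀ = 2·7^{m₀}`) such that AT EVERY POINT OF `T`: `curl ψ̂ = v` and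
`‖Dⁿψ̂‖ ≤ ‖crossCLM‖·S·M·λ·(ρ₀ + n)·Lⁿ` (`n ≤ 3`).  Construction: the cluster cover `T ⊆ ⋃ B(cᵢ, ρᵢ)`
(`λ ≤ ρᵢ ≤ ρ₀λ`, threefold dilates disjoint; `exists_cluster_cover`), the radial potentials `ψ_{cᵢ}`
(`radialPotential_props`) and smooth bumps `χᵢ` (`= 1` on `B̄(cᵢ, 2ρᵢ)`, `= 0` off `B(cᵢ, 5ρᵢ/2)`):
`ψ̂ = Σᵢ χᵢ·ψ_{cᵢ}` equals `ψ_{cᵢ}` on the open ball `B(cᵢ, 2ρᵢ) ⊇ B(cᵢ, ρᵢ)` (the other bumps vanish there by the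
separation `dist(cᵢ,cⱼ) ≥ 3ρᵢ + 3ρⱼ`), so no gauge error is ever seen on `T`.
HONEST FRAMING: a construction for one class of vector fields; nothing about Navier–Stokes is proved; no summit is proved
by a line. [folklore]
-/

noncomputable section

open Set Filter Topology MeasureTheory Metric Module
open scoped InnerProductSpace RealInnerProductSpace ENNReal ContDiff
open Literature.Analysis.FluidPDE
open Summit.NavierStokesRegularity.NavierStokesRegularity.Theorems.DepletionLadder.KStar.HalfSpace

namespace Summit.NavierStokesRegularity.NavierStokesRegularity.Theorems

-- the problem directory repeats the summit name (`NavierStokesRegularity/NavierStokesRegularity`)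
set_option linter.dupNamespace false

namespace DepletionLadder.KStar.BangBang

variable {v : E3 → E3}

/-- Volume of a finite union of closed balls of radii `≤ r`: `vol(⋃ᵢ B̄(cᵢ, ρᵢ)) ≤ k·r³·|B₁|` (as a real number).
[folklore] -/
theorem toReal_volume_iUnion_closedBall_le {k : ℕ} (c : Fin k → E3) (ρ : Fin k → ℝ) {r : ℝ} (hr : 0 ≤ r)
    (hρ : ∀ i, ρ i ≤ r) :
    (volume (⋃ i, closedBall (c i) (ρ i))).toReal ≤ k * r ^ 3 * (volume (ball (0 : E3) 1)).toReal := by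
  have hV : volume (ball (0 : E3) 1) ≠ ⊤ := measure_ball_lt_top.ne
  have hle : volume (⋃ i, closedBall (c i) (ρ i)) ≤ ∑ _i : Fin k, ENNReal.ofReal (r ^ 3) * volume (ball (0 : E3) 1) := by
    refine (measure_iUnion_fintype_le _ _).trans (Finset.sum_le_sum fun i _ => ?_)
    calc volume (closedBall (c i) (ρ i)) ≤ volume (closedBall (c i) r) := measure_mono (closedBall_subset_closedBall (hρ i))
      _ = ENNReal.ofReal (r ^ 3) * volume (ball (0 : E3) 1) := by
          rw [Measure.addHaar_closedBall volume (c i) hr, finrank_euclideanSpace_fin]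
  rw [Finset.sum_const, Finset.card_univ, Fintype.card_fin, nsmul_eq_mul] at hle
  have hfin : (k : ℝ≥0∞) * (ENNReal.ofReal (r ^ 3) * volume (ball (0 : E3) 1)) ≠ ⊤ :=
    ENNReal.mul_ne_top (ENNReal.natCast_ne_top k) (ENNReal.mul_ne_top ENNReal.ofReal_ne_top hV)
  have h := (ENNReal.toReal_le_toReal (ne_top_of_le_ne_top hfin hle) hfin).2 hle
  rw [ENNReal.toReal_mul, ENNReal.toReal_mul, ENNReal.toReal_natCast, ENNReal.toReal_ofReal (pow_nonneg hr 3)] at h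
  linarith

/-- **The patched radial potential over the cluster cover of the half-top set.** See the module docstring. [folklore] -/
theorem exists_patchedPotential (hv : ContDiff ℝ ∞ v) (hdiv : VectorCalculus.IsDivFree v) {S M L lam : ℝ}
    (hS : 0 ≤ S) (hM : 0 ≤ M) (hL : 0 ≤ L) (hlam : 0 < lam) (hlamL : lam * L = 1)
    (hK : ∀ i, i ≤ 3 → ∀ z, ‖iteratedFDeriv ℝ i v z‖ ≤ S * M * L ^ i) (m₀ : ℕ)
    (hbound : ∀ P : Finset E3, (↑P : Set E3) ⊆ {x | M / 2 ≤ ‖v x‖} →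
      (∀ p ∈ P, ∀ q ∈ P, p ≠ q → lam ≤ dist p q) → P.card ≤ m₀) :
    ∃ (ψ : E3 → E3) (K : Set E3), ContDiff ℝ ∞ ψ ∧ IsCompact K ∧
      (volume K).toReal ≤ m₀ * (2 * 7 ^ m₀ * lam) ^ 3 * (volume (ball (0 : E3) 1)).toReal ∧
      {x | M / 2 ≤ ‖v x‖} ⊆ K ∧
      ∀ x, M / 2 ≤ ‖v x‖ → curl ψ x = v x ∧
        ∀ n, n ≤ 3 → ‖iteratedFDeriv ℝ n ψ x‖ ≤ ‖crossCLM‖ * S * M * lam * (2 * 7 ^ m₀ + n) * L ^ n := by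
  classical
  obtain ⟨k, c, ρ, hk, -, hρ, hcov, hdisj⟩ := exists_cluster_cover {x | M / 2 ≤ ‖v x‖} hlam m₀ hbound
  set ρ₀ : ℝ := 2 * 7 ^ m₀ with hρ₀
  have hρ₀0 : 0 ≤ ρ₀ := by rw [hρ₀]; positivity
  have hρpos : ∀ i, 0 < ρ i := fun i => hlam.trans_le (hρ i).1
  have hdist : ∀ i j, i ≠ j → 3 * ρ i + 3 * ρ j ≤ dist (c i) (c j) := fun i j hij =>
    (disjoint_ball_ball_iff (by linarith [hρpos i]) (by linarith [hρpos j])).1 (hdisj i j hij)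
  -- the radial potentials about the cluster centres
  set ψc : Fin k → E3 → E3 := fun i x => conePotential (fun y => v (y + c i)) (x - c i) with hψc
  have hpot : ∀ i, ContDiff ℝ ∞ (ψc i) ∧ (∀ x, curl (ψc i) x = v x) ∧
      ∀ n, n ≤ 3 → ∀ x, dist x (c i) ≤ ρ₀ * lam →
        ‖iteratedFDeriv ℝ n (ψc i) x‖ ≤ ‖crossCLM‖ * S * M * lam * (ρ₀ + n) * L ^ n :=
    fun i => radialPotential_props hv hdiv (c i) hS hM hL hlamL (n := 3) (ρ₀ := ρ₀) hK
  -- the bumps and the patched potential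
  let χ : ∀ i : Fin k, ContDiffBump (c i) := fun i =>
    ⟨2 * ρ i, 5 / 2 * ρ i, by linarith [hρpos i], by linarith [hρpos i]⟩
  set ψ : E3 → E3 := fun x => ∑ i, (χ i) x • ψc i x with hψdef
  have hψ : ContDiff ℝ ∞ ψ := ContDiff.sum fun i _ => (χ i).contDiff.smul (hpot i).1
  -- local structure: on `B(cᵢ, 2ρᵢ)` the patched potential IS `ψ_{cᵢ}`
  have hloc : ∀ i, ∀ y ∈ ball (c i) (2 * ρ i), ψ y = ψc i y := by
    intro i y hy
    rw [hψdef]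
    simp only
    rw [Finset.sum_eq_single i]
    · rw [(χ i).one_of_mem_closedBall (by simpa [mem_closedBall] using (mem_ball.1 hy).le), one_smul]
    · intro j _ hji
      have hfar : (χ j).rOut ≤ dist y (c j) := by
        show 5 / 2 * ρ j ≤ dist y (c j)
        have h1 := hdist i j (Ne.symm hji)
        have h2 := dist_triangle (c i) y (c j)
        rw [dist_comm (c i) y] at h2
        have h3 : dist y (c i) < 2 * ρ i := mem_ball.1 hy
        have h4 := hρpos i
        have h5 := hρpos j
        linarith
      rw [(χ j).zero_of_le_dist hfar, zero_smul]
    · intro h; exact absurd (Finset.mem_univ i) h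
  -- the compact set `K`
  set K : Set E3 := ⋃ i, closedBall (c i) (ρ i) with hKdef
  have hKc : IsCompact K := isCompact_iUnion fun i => isCompact_closedBall _ _
  have hTK : {x | M / 2 ≤ ‖v x‖} ⊆ K := fun x hx => by
    obtain ⟨i, hi⟩ := mem_iUnion.1 (hcov hx)
    exact mem_iUnion.2 ⟨i, ball_subset_closedBall hi⟩
  have hvol : (volume K).toReal ≤ m₀ * (2 * 7 ^ m₀ * lam) ^ 3 * (volume (ball (0 : E3) 1)).toReal := by
    have h := toReal_volume_iUnion_closedBall_le c ρ (r := ρ₀ * lam) (by positivity) (fun i => (hρ i).2)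
    refine h.trans ?_
    have hk' : (k : ℝ) ≤ m₀ := by exact_mod_cast hk
    have : (k : ℝ) * (ρ₀ * lam) ^ 3 * (volume (ball (0 : E3) 1)).toReal ≤
        m₀ * (ρ₀ * lam) ^ 3 * (volume (ball (0 : E3) 1)).toReal := by gcongr
    simpa [hρ₀] using this
  refine ⟨ψ, K, hψ, hKc, hvol, hTK, fun x hx => ?_⟩
  obtain ⟨i, hi⟩ := mem_iUnion.1 (hcov hx)
  have hdi : dist x (c i) < ρ i := mem_ball.1 hi
  have hx2 : x ∈ ball (c i) (2 * ρ i) := mem_ball.2 (by linarith [hρpos i])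
  have hev : ψ =ᶠ[𝓝 x] ψc i := by
    filter_upwards [isOpen_ball.mem_nhds hx2] with y hy
    exact hloc i y hy
  have hdist' : dist x (c i) ≤ ρ₀ * lam := hdi.le.trans (hρ i).2
  refine ⟨?_, fun n hn => ?_⟩
  · rw [curl_eq_curlCLM, hev.fderiv_eq, ← curl_eq_curlCLM]
    exact (hpot i).2.1 x
  · rw [(hev.iteratedFDeriv ℝ n).eq_of_nhds]
    exact (hpot i).2.2 n hn x hdist'

end DepletionLadder.KStar.BangBang

end Summit.NavierStokesRegularity.NavierStokesRegularity.Theorems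

end
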